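import Summits.ResolutionOfSingularities.ResolutionOfSingularities.Theorems.SyzygyFlatteningHigherRankTerminationTowerLocalisation
import Summits.ResolutionOfSingularities.ResolutionOfSingularities.Theorems.SyzygyFlatteningHigherRankTerminationBaseChangedDatum
import HarnessLib

/-!
# Transport of chart data along ring isomorphisms; the switch of minimal generators

Auxiliary lemmas for `stub_syzygyDatumChart` (crux `SyzygyFlattening.Globalisation`,
stmt-ResolutionOfSingularities-17061, line `birth`; main file
`SyzygyFlatteningGlobalisationSyzygyDatumChart.lean`), none of which mentions schemes:

* `map_sInf_nonRegular_of_bijective` — the ideal `⋂ {𝔭 : R_𝔭 not regular}` of the non-regular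
  locus is transported by a bijective ring map (primes correspond, and the local rings at
  corresponding primes are isomorphic, `IsLocalization.ringEquivOfRingEquiv`);
* `datum_of_bijective` — a raw chart datum `(b, d, ε, r, ι)` (finite free resolution of `R ⧸ J`
  plus an injective embedding with torsion cokernel of the `n`-th syzygy module) is transported
  along a bijective ring map `f : R → S` to a datum for `S ⧸ J S` (the flat injective base change
  `baseChangedDatum_alg` of the sibling line), with the maximal minors of `ι` becoming maximal
  minors of `ι₁` and all maximal minors of `ι₁` lying in the extension of the ideal of maximal
  minors of `ι`;
* `adjoin_le_locAt_adjoin_of_unit`, `locAt_adjoin_eq_of_unit` — two charts `k[SA ∪ R₁]`,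
  `k[SA ∪ R₂] ⊆ O` that differ by an `O`-unit `c` (`R₁ c ⊆ k[SA ∪ R₂] ∋ c`,
  `R₂ c⁻¹ ⊆ k[SA ∪ R₁] ∋ c⁻¹`) have the same localisation `locAt O` at the centre of `O`;
* `locAt_adjoin_minors_eq_adjoin_ideal` — THE SWITCH OF MINIMAL GENERATORS: for the maximal
  minors `D g` of a datum with an `O`-minimal `x₁` and an ideal `N` read in `K` through `sec`
  with an `O`-minimal `u₀ ∈ N`, generating each other over `SA`, the charts `k[SA, D g / D x₁]`
  and `k[SA, sec N / sec u₀]` have the same localisation at the centre (`c = D x₁ / sec u₀`).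

Sources: Novacoski–Spivakovsky 2014, Def. 2.11 (the chart of a local blowing up selected by a
valuation: any generator of minimal value); Matsumura §19 (finite free resolutions under base
change); Villamayor 2006, 3.4 (representatives of the ideal of maximal minors).
-/

noncomputable section

-- single-problem summit: the doubled namespace component `ResolutionOfSingularities` is forced
set_option linter.dupNamespace false

namespace Summit.ResolutionOfSingularities.ResolutionOfSingularities.Theorems.SyzygyFlattening

open Literature.AlgebraicGeometry.Resolution

/-! ## Transport along a ring isomorphism -/

/-- **The ideal of the non-regular locus is transported by a ring isomorphism**: for a bijective
ring map `f : R → S`, the extension of `⋂ {𝔭 : R_𝔭 not regular}` is `⋂ {𝔮 : S_𝔮 not regular}`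
(the primes correspond under `f`, and `R_{f⁻¹𝔮} ≅ S_𝔮`). [folklore] -/
theorem map_sInf_nonRegular_of_bijective {R S : Type*} [CommRing R] [CommRing S] (f : R →+* S)
    (hf : Function.Bijective f) :
    (sInf ((fun 𝔭 : PrimeSpectrum R => 𝔭.asIdeal) ''
        {𝔭 : PrimeSpectrum R | ¬ IsRegularLocalRing (Localization.AtPrime 𝔭.asIdeal)})).map f =
      sInf ((fun 𝔮 : PrimeSpectrum S => 𝔮.asIdeal) ''
        {𝔮 : PrimeSpectrum S | ¬ IsRegularLocalRing (Localization.AtPrime 𝔮.asIdeal)}) := by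
  set e : R ≃+* S := RingEquiv.ofBijective f hf
  -- local rings at corresponding primes are isomorphic
  have key : ∀ 𝔮 : PrimeSpectrum S,
      IsRegularLocalRing (Localization.AtPrime (Ideal.comap f 𝔮.asIdeal)) ↔
        IsRegularLocalRing (Localization.AtPrime 𝔮.asIdeal) := fun 𝔮 => by
    let φ := IsLocalization.ringEquivOfRingEquiv
      (Localization.AtPrime (Ideal.comap f 𝔮.asIdeal)) (Localization.AtPrime 𝔮.asIdeal)
      e (Ideal.map_primeCompl_comap_of_surjective f hf.surjective 𝔮.asIdeal)
    exact ⟨fun _ => .of_ringEquiv φ, fun _ => .of_ringEquiv φ.symm⟩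
  have hsymm : ∀ x : R, e.symm (f x) = x := fun x => e.symm_apply_apply x
  ext y
  constructor
  · intro hy
    obtain ⟨x, hx, rfl⟩ := (Ideal.mem_map_iff_of_surjective f hf.surjective).mp hy
    rw [Ideal.mem_sInf] at hx ⊢
    rintro _ ⟨𝔮, h𝔮, rfl⟩
    exact hx ⟨PrimeSpectrum.comap f 𝔮, fun h => h𝔮 ((key 𝔮).mp h), rfl⟩
  · intro hy
    obtain ⟨x, rfl⟩ := hf.surjective y
    refine Ideal.mem_map_of_mem f ?_
    rw [Ideal.mem_sInf] at hy ⊢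
    rintro _ ⟨𝔭, h𝔭, rfl⟩
    -- the prime of `S` over `𝔭`
    have h𝔮𝔭 : PrimeSpectrum.comap f (PrimeSpectrum.comap (e.symm : S →+* R) 𝔭) = 𝔭 := by
      ext z
      show e.symm (f z) ∈ 𝔭.asIdeal ↔ z ∈ 𝔭.asIdeal
      rw [hsymm]
    have h𝔮 : ¬ IsRegularLocalRing
        (Localization.AtPrime (PrimeSpectrum.comap (e.symm : S →+* R) 𝔭).asIdeal) := fun h => by
      refine h𝔭 ?_
      rw [← h𝔮𝔭]
      exact (key _).mpr h
    have hx : e.symm (f x) ∈ 𝔭.asIdeal := hy ⟨PrimeSpectrum.comap (e.symm : S →+* R) 𝔭, h𝔮, rfl⟩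
    rwa [hsymm] at hx

/-- **Transport of a chart datum along a ring isomorphism.** For a bijective ring map
`f : R → S` (`R` a domain), `J₁ = J S`, a finite free resolution `(b, d, ε)` of `R ⧸ J` and an
injective `ι : range (d n) → R^r` with torsion cokernel: there is a datum `(b, d₁, ε₁, r, ι₁)`
over `S` for `S ⧸ J₁` (base change along the flat injective `f`, `baseChangedDatum_alg`) such
that every maximal minor of `ι` is (up to `f`) a maximal minor of `ι₁`, and every maximal minor
of `ι₁` lies in the ideal generated by the images of those of `ι`.
[cite: Matsumura1987, §19 (after Lemma 4)] -/
theorem datum_of_bijective {R S : Type*} [CommRing R] [IsDomain R] [CommRing S] (f : R →+* S)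
    (hf : Function.Bijective f) (J : Ideal R) (J₁ : Ideal S) (hJ : J₁ = J.map f) (n : ℕ)
    (b : ℕ → ℕ) (d : (i : ℕ) → ((Fin (b (i + 1)) → R) →ₗ[R] (Fin (b i) → R)))
    (ε : (Fin (b 0) → R) →ₗ[R] (R ⧸ J)) (r : ℕ)
    (ι : ↥(LinearMap.range (d n)) →ₗ[R] (Fin r → R))
    (hε : Function.Surjective ε) (h0 : Function.Exact (d 0) ε)
    (hs : ∀ i : ℕ, Function.Exact (d (i + 1)) (d i)) (hι : Function.Injective ι)
    (htors : ∀ z : Fin r → R, ∃ a : R, a ≠ 0 ∧ a • z ∈ LinearMap.range ι) :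
    ∃ (d₁ : (i : ℕ) → ((Fin (b (i + 1)) → S) →ₗ[S] (Fin (b i) → S)))
      (ε₁ : (Fin (b 0) → S) →ₗ[S] (S ⧸ J₁))
      (ι₁ : ↥(LinearMap.range (d₁ n)) →ₗ[S] (Fin r → S)),
      (Function.Surjective ε₁ ∧ Function.Exact (d₁ 0) ε₁ ∧
          (∀ i : ℕ, Function.Exact (d₁ (i + 1)) (d₁ i)) ∧ Function.Injective ι₁ ∧
          (∀ z : Fin r → S, ∃ a : S, a ≠ 0 ∧ a • z ∈ LinearMap.range ι₁)) ∧
      (∀ g : Fin r → ↥(LinearMap.range (d n)), ∃ g₁ : Fin r → ↥(LinearMap.range (d₁ n)),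
        ∀ i j, ι₁ (g₁ i) j = f (ι (g i) j)) ∧
      (∀ g' : Fin r → ↥(LinearMap.range (d₁ n)),
        Matrix.det (Matrix.of fun i j => ι₁ (g' i) j) ∈
          Ideal.span (Set.range fun g : Fin r → ↥(LinearMap.range (d n)) =>
            f (Matrix.det (Matrix.of fun i j => ι (g i) j)))) := by
  letI : Algebra R S := f.toAlgebra
  set e : R ≃+* S := RingEquiv.ofBijective f hf
  have hsymm : ∀ x : R, e.symm (f x) = x := fun x => e.symm_apply_apply x
  -- `S ≅ R` as an `R`-module (via `e⁻¹`), so `S` is `R`-flat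
  let L : S ≃ₗ[R] R :=
    { toFun := e.symm
      invFun := e
      map_add' := fun a a' => map_add e.symm a a'
      map_smul' := fun c a => by
        change e.symm (f c * a) = c * e.symm a
        rw [map_mul, hsymm]
      left_inv := fun a => e.apply_symm_apply a
      right_inv := fun c => e.symm_apply_apply c }
  haveI : Module.Flat R S := Module.Flat.of_linearEquiv L
  have hinj : Function.Injective (algebraMap R S) := hf.injective
  obtain ⟨d₁, ε₁, ι₁, g₁, hfive, happ, hspan⟩ :=
    baseChangedDatum_alg hinj J J₁ hJ n b d ε r ι hε h0 hs hι htors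
  exact ⟨d₁, ε₁, ι₁, hfive, fun g => ⟨fun i => g₁ (g i), fun i j => happ (g i) j⟩, hspan⟩

/-! ## The switch of minimal generators -/

variable {k K : Type} [Field k] [Field K] [Algebra k K]

/-- One inclusion of the switch: if `c` is an `O`-unit of `k[SA ∪ R₂] ⊆ O` and every `y ∈ R₁`
has `y * c ∈ k[SA ∪ R₂]`, then `k[SA ∪ R₁] ⊆ locAt O (k[SA ∪ R₂])` (`y = (y c) c⁻¹`, and `c⁻¹`
lies in the localisation at the centre, `inv_mem_locAt`). [folklore] -/
theorem adjoin_le_locAt_adjoin_of_unit (O : ValuationSubring K) {SA R₁ R₂ : Set K}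
    (h₂O : (Algebra.adjoin k (SA ∪ R₂)).toSubring ≤ O.toSubring) {c : K}
    (hc : O.valuation c = 1) (hc₂ : c ∈ Algebra.adjoin k (SA ∪ R₂))
    (h₁ : ∀ y ∈ R₁, y * c ∈ Algebra.adjoin k (SA ∪ R₂)) :
    Algebra.adjoin k (SA ∪ R₁) ≤ locAt O (Algebra.adjoin k (SA ∪ R₂)) := by
  have hc0 : c ≠ 0 := ne_zero_of_valuation_eq_one hc
  refine Algebra.adjoin_le ?_
  rintro y (hy | hy)
  · exact self_le_locAt O _ (Algebra.subset_adjoin (Or.inl hy))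
  · rw [← mul_inv_cancel_right₀ hc0 y]
    exact mul_mem (self_le_locAt O _ (h₁ y hy))
      (inv_mem_locAt O _ h₂O (self_le_locAt O _ hc₂) hc)

/-- **Two charts sharing an `O`-unit have the same localisation at the centre.** If
`k[SA ∪ R₁], k[SA ∪ R₂] ⊆ O`, `c` is an `O`-unit with `c ∈ k[SA ∪ R₂]`, `c⁻¹ ∈ k[SA ∪ R₁]`,
`R₁ · c ⊆ k[SA ∪ R₂]` and `R₂ · c⁻¹ ⊆ k[SA ∪ R₁]`, then
`locAt O (k[SA ∪ R₁]) = locAt O (k[SA ∪ R₂])` (both inclusions by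
`adjoin_le_locAt_adjoin_of_unit`, then monotonicity and idempotence of `locAt O`).
[cite: NovacoskiSpivakovsky2014, Def. 2.11] -/
theorem locAt_adjoin_eq_of_unit (O : ValuationSubring K) {SA R₁ R₂ : Set K}
    (h₁O : (Algebra.adjoin k (SA ∪ R₁)).toSubring ≤ O.toSubring)
    (h₂O : (Algebra.adjoin k (SA ∪ R₂)).toSubring ≤ O.toSubring) {c : K}
    (hc : O.valuation c = 1) (hc₂ : c ∈ Algebra.adjoin k (SA ∪ R₂))
    (hc₁ : c⁻¹ ∈ Algebra.adjoin k (SA ∪ R₁))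
    (h₁ : ∀ y ∈ R₁, y * c ∈ Algebra.adjoin k (SA ∪ R₂))
    (h₂ : ∀ y ∈ R₂, y * c⁻¹ ∈ Algebra.adjoin k (SA ∪ R₁)) :
    locAt O (Algebra.adjoin k (SA ∪ R₁)) = locAt O (Algebra.adjoin k (SA ∪ R₂)) := by
  have hc' : O.valuation c⁻¹ = 1 := by rw [map_inv₀, hc, inv_one]
  apply le_antisymm
  · exact (locAt_mono O (adjoin_le_locAt_adjoin_of_unit O h₂O hc hc₂ h₁)).trans
      (le_of_eq (locAt_locAt O _ h₂O))
  · exact (locAt_mono O (adjoin_le_locAt_adjoin_of_unit O h₁O hc' hc₁ h₂)).trans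
      (le_of_eq (locAt_locAt O _ h₁O))

/-- **The switch of minimal generators.** Let `SA ⊆ O` (`k ⊆ O`), `D : G → K` ("the maximal
minors of a datum") with an `O`-minimal `x₁` (`D x₁ ≠ 0`, all `D g / D x₁ ∈ O`), and
`sec : R → K`, `N` an ideal of `R`, `u₀ ∈ N` with `sec u₀ ≠ 0` `O`-minimal on `sec N`
(all `sec n / sec u₀ ∈ O`). Assume the two families generate each other over `SA`: every
`D g / sec u₀` lies in every subring containing `SA` and the `sec n / sec u₀`, and every
`sec n / D x₁` lies in every subring containing `SA` and the `D g / D x₁`. Then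
`locAt O (k[SA, D g / D x₁]) = locAt O (k[SA, sec n / sec u₀])`: `c = D x₁ / sec u₀` is an
`O`-unit of both algebras (`locAt_adjoin_eq_of_unit`). [cite: NovacoskiSpivakovsky2014, Def. 2.11] -/
theorem locAt_adjoin_minors_eq_adjoin_ideal (O : ValuationSubring K)
    (hk : ∀ c : k, algebraMap k K c ∈ O) {SA : Set K} (hSA : SA ⊆ O) {G : Type*} (D : G → K)
    (x₁ : G) (hx0 : D x₁ ≠ 0) (hminX : ∀ g, D g * (D x₁)⁻¹ ∈ O) {R : Type*} [Semiring R]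
    (sec : R → K) (N : Ideal R) (u₀ : R) (hu₀ : u₀ ∈ N) (hsu0 : sec u₀ ≠ 0)
    (hminU : ∀ n ∈ N, sec n * (sec u₀)⁻¹ ∈ O)
    (Hsu : ∀ T : Subring K, SA ⊆ T → (∀ n ∈ N, sec n * (sec u₀)⁻¹ ∈ T) →
      ∀ g, D g * (sec u₀)⁻¹ ∈ T)
    (HDx : ∀ T : Subring K, SA ⊆ T → (∀ g, D g * (D x₁)⁻¹ ∈ T) →
      ∀ n ∈ N, sec n * (D x₁)⁻¹ ∈ T) :
    locAt O (Algebra.adjoin k (SA ∪ {y : K | ∃ g, y = D g * (D x₁)⁻¹})) =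
      locAt O (Algebra.adjoin k (SA ∪ {y : K | ∃ n ∈ N, y = sec n * (sec u₀)⁻¹})) := by
  set A₁ := Algebra.adjoin k (SA ∪ {y : K | ∃ g, y = D g * (D x₁)⁻¹}) with hA₁
  set A₂ := Algebra.adjoin k (SA ∪ {y : K | ∃ n ∈ N, y = sec n * (sec u₀)⁻¹}) with hA₂
  have h₁O : A₁.toSubring ≤ O.toSubring :=
    adjoin_toSubring_le_valuationSubring O hk
      (Set.union_subset hSA (by rintro _ ⟨g, rfl⟩; exact hminX g))
  have h₂O : A₂.toSubring ≤ O.toSubring :=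
    adjoin_toSubring_le_valuationSubring O hk
      (Set.union_subset hSA (by rintro _ ⟨n, hn, rfl⟩; exact hminU n hn))
  have hSA₁ : SA ⊆ A₁.toSubring := fun y hy => Algebra.subset_adjoin (Or.inl hy)
  have hSA₂ : SA ⊆ A₂.toSubring := fun y hy => Algebra.subset_adjoin (Or.inl hy)
  have hR₁ : ∀ g, D g * (D x₁)⁻¹ ∈ A₁.toSubring := fun g =>
    Algebra.subset_adjoin (Or.inr ⟨g, rfl⟩)
  have hR₂ : ∀ n ∈ N, sec n * (sec u₀)⁻¹ ∈ A₂.toSubring := fun n hn =>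
    Algebra.subset_adjoin (Or.inr ⟨n, hn, rfl⟩)
  -- the two families divided by the other denominator
  have H₂ := Hsu A₂.toSubring hSA₂ hR₂
  have H₁ := HDx A₁.toSubring hSA₁ hR₁
  have H₂O := Hsu O.toSubring hSA hminU
  have H₁O := HDx O.toSubring hSA hminX
  -- the unit `c = D x₁ / sec u₀`
  set c : K := D x₁ * (sec u₀)⁻¹ with hc
  have hcinv : c⁻¹ = sec u₀ * (D x₁)⁻¹ := by rw [hc, mul_inv_rev, inv_inv]
  have hc0 : c ≠ 0 := mul_ne_zero hx0 (inv_ne_zero hsu0)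
  have hcO : c ∈ O := H₂O x₁
  have hciO : c⁻¹ ∈ O := by rw [hcinv]; exact H₁O u₀ hu₀
  have hval : O.valuation c = 1 := valuation_eq_one_of_inv_mem O hcO hciO hc0
  have hc₂ : c ∈ A₂ := H₂ x₁
  have hc₁ : c⁻¹ ∈ A₁ := by rw [hcinv]; exact H₁ u₀ hu₀
  refine locAt_adjoin_eq_of_unit O h₁O h₂O hval hc₂ hc₁ ?_ ?_
  · rintro _ ⟨g, rfl⟩
    have : D g * (D x₁)⁻¹ * c = D g * (sec u₀)⁻¹ := by
      rw [hc, mul_assoc, inv_mul_cancel_left₀ hx0]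
    rw [this]
    exact H₂ g
  · rintro _ ⟨n, hn, rfl⟩
    have : sec n * (sec u₀)⁻¹ * c⁻¹ = sec n * (D x₁)⁻¹ := by
      rw [hcinv, mul_assoc, inv_mul_cancel_left₀ hsu0]
    rw [this]
    exact H₁ n hn

end Summit.ResolutionOfSingularities.ResolutionOfSingularities.Theorems.SyzygyFlattening

end
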